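import Mathlib.Algebra.CharZero.Infinite
import Literature.Barriers.ValiantsHypothesis.AlgebraicNaturalProofsGenerators
import Literature.Computability.AlgebraicComplexity.KabanetsImpagliazzoHardness
import Literature.Computability.AlgebraicComplexity.KRSTSelection
import HarnessLib

/-!
# Algebraically natural proofs: the HARDNESS door — Kabanets–Impagliazzo generators feed the
# barrier (KRST 2022 §3.5 typed against `SuccinctHittingSetsForVP`; the succinctness arrow isolated)

Third file of the barrier entry `AlgebraicNaturalProofs` (FSV Thm. 4 / Question 6) after
`AlgebraicNaturalProofsGenerators` (FSV Def. 7 / Lemma 14: succinct generators give succinct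
hitting sets; the design generator `designGenerator f S` and its succinctness arrow). Here the
generator is fed by HARDNESS, as in Kumar–Ramya–Saptharishi–Tengse 2022 (the `VNP` theorem):

* the tree's Kabanets–Impagliazzo engine
  (`Literature/Computability/AlgebraicComplexity/KabanetsImpagliazzo{Generator,Hardness}.lean`:
  hybrid argument PROVED; the root case of Kaltofen's factor theorem PROVED in `RootLifting.lean`,
  so the engine is UNCONDITIONAL in characteristic zero) says: if `f` is hard enough relative to
  the level `(s, Δ)` and to the design's intersection parameter `r`, then
  `KI-gen(f) = (f(y|_{S_m}))_m` is a hitting set generator for `{D : L(D) ≤ s, deg D ≤ Δ}` — KRST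
  Lemma 8;
* the door (`isSuccinctHittingSet_of_designGenerator`) then says: if moreover every output
  `(f(a|_{S_m}))_m` is the coefficient vector of a member of the simple class `𝒞`, then `𝒞` is a
  succinct hitting set — for `𝒞 = SmallCircuits F n b` this is FSV Question 6 at level `(n, a, b)`.

**Proved here (no named-fact hypotheses).**

* `kiGenerator_eq_designGenerator` — the two tree spellings of `KI-gen(f)` agree.
* `isSuccinctHittingSet_of_hard_designGenerator` — **the fixed-`n` engine**: over a field of
  characteristic zero, a design `e : degLEMonomials n → (β ↪ α)` with pairwise intersections
  `≤ r`, a polynomial `f ∈ F[β]` with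
  `L(f) > (N^a + N_n (deg f + 1)^r (2 deg f + 2) + N^a · max 1 (deg f) + deg f + #β + 4)^7`
  (`N = binom(2n,n)`, `N_n = #degLEMonomials n`), and `𝒞`-SUCCINCTNESS of `KI-gen(f)` (every
  `Σ_m f(a|_{S_m}) x^m` has its coefficient vector in `𝒞`) give
  `IsSuccinctHittingSet (degLEMonomials n) 𝒞 (Distinguishers F n a)`.
* `succinctHittingSetsForVP_of_hard_designGenerators` — **the asymptotic statement for `VP`**: if
  for every level `a` there are `b, n₀` and, for each `n ≥ n₀`, such data `(e, r, f)` whose KI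
  generator is `SmallCircuits F n b`-succinct, then `SuccinctHittingSetsForVP F` (FSV Question 6),
  hence (`algebraicNaturalProofs_holds`) no algebraically natural proof of any level against `VP`.
* `isSuccinctHittingSet_of_permanent_hard` — the fixed-`n` engine with `f = Perm_[p]`
  (`perPad`) and `e = krstDesign p n`, KRST's Reed–Solomon design indexed by the coordinates
  (`Literature/Computability/AlgebraicComplexity/KRSTDesign.lean`): the succinctness hypothesis
  is then a statement about ONE explicit polynomial family, `y ↦ Σ_{|μ|≤n} Perm_[p](y|_{S_μ}) x^μ`.

**Status of the succinctness hypothesis (the only non-kernel input of these statements).** For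
`𝒞` = KRST's `VNP` slice it is KRST §3.4 and is PROVED in the tree (`KRSTSuccinctness.lean`,
assembled in `AlgebraicNaturalProofsKRSTVNP.lean`: KRST's Main Theorem, unconditional). For
`𝒞 = SmallCircuits F n b` (`VP`) it is NOT in print ("our proof crucially relies on some of the
properties of VNP and does not appear to extend to VP", KRST §1.2; "Clearly, more work is
required", Bürgisser 2024 §7.3) and, by the ruling of record for this barrier (cell
`valiant-natproofs`, D-0053), the full algebraic natural-proofs barrier for `VP` is CONDITIONAL on
such a succinct-generator / algebraic-PRF-type conjecture and is NOT derivable from permanent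
hardness by the known generator technology: kernel no-go theorems show that no KI / NW / KRST
design generator planted with the permanent is JOINTLY `VP`-succinct under permanent hardness
(`AlgebraicNaturalProofsPlanting.not_jointlySuccinct_of_plantsPermanentAt`; planner files
`Chain.lean`/`Chain2.lean` §A), and that the per-seed form for KRST's own design fails outside a
narrow window of parameters (planner file `Sketch-p2g2b.lean`, `not_KRSTSuccinctInVP`). The
theorems below therefore isolate that hypothesis (`hsucc`) and assert nothing about it.

## References

* [KumarRamyaSaptharishiTengse2022] M. Kumar, C. Ramya, R. Saptharishi, A. Tengse, *If VNP is
  hard, then so are equations for it*, STACS 2022, Lemma 8, §3.4–3.5, §4.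
* [KabanetsImpagliazzo2003] V. Kabanets, R. Impagliazzo, *Derandomizing polynomial identity tests
  means proving circuit lower bounds*, STOC 2003, Lemma 30.
* [ForbesShpilkaVolk2018] M. A. Forbes, A. Shpilka, B. L. Volk, *Succinct hitting sets and
  barriers to proving lower bounds for algebraic circuits*, Theory Comput. 14 (2018), Def. 7,
  Lemma 14, Question 6.
* [Burgisser2024Completeness] P. Bürgisser, *Completeness classes in algebraic complexity theory*,
  arXiv:2406.06217, Thm. 3.2 and §7.3.
* [DuttaSaxenaSinhababu2018] P. Dutta, N. Saxena, A. Sinhababu, *Discovering the roots*, STOC 2018,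
  §1.3 (root closure, `RootLifting.lean`).
-/

noncomputable section

namespace Literature.Barriers.ValiantsHypothesis

open Literature.Computability.AlgebraicComplexity Literature.Computability.MetaComplexity
  MvPolynomial

/-! ### The two spellings of `KI-gen` -/

section Spelling

variable {F : Type*} [CommSemiring F] {ι α β : Type*}

/-- The engine's `kiGenerator f e` is the door's `designGenerator f (e ·)`.
[cite: KumarRamyaSaptharishiTengse2022, Lemma 8] -/
theorem kiGenerator_eq_designGenerator {σ : Type*} {M : Set (σ →₀ ℕ)} (f : MvPolynomial β F)
    (e : M → (β ↪ α)) : kiGenerator f e = designGenerator f (fun m => ⇑(e m)) := rfl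

end Spelling

/-! ### The fixed-`n` engine: hardness + design + `VP`-succinctness ⇒ hitting at level `(n, a, b)` -/

section Engine

variable {F : Type*} [Field F] [CharZero F] {α β : Type*} [Fintype β] [DecidableEq β]
  [DecidableEq α]

/-- **The hardness door at a fixed `n`, for any simple class `𝒞`** (KRST §3.5, typed against the
tree's framework; unconditional). Over a field of characteristic zero, let
`e : degLEMonomials n → (β ↪ α)` assign to each coordinate a block of seed variables, pairwise
meeting in `≤ r` points, and let `f ∈ F[β]` be hard:
`L(f) > (N^a + N_n · (deg f + 1)^r (2 deg f + 2) + N^a · max 1 (deg f) + deg f + #β + 4)^7`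
(`N = binom(2n, n)`, `N_n = #degLEMonomials n`). If `KI-gen(f)` is `𝒞`-succinct — for every seed
`y` some `g ∈ 𝒞` has `coeff_m g = f(y ∘ e_m)` for all `m` — then `𝒞` hits every nonzero level-`a`
distinguisher. With `𝒞` a `VNP` slice this is KRST's theorem at level `(n, a)`; with
`𝒞 = SmallCircuits F n b` it is FSV Question 6 at `(n, a, b)` under a succinctness hypothesis
not in print (see the file header). (KI engine `kiGenerator_isHittingSetGenerator` + door
`isSuccinctHittingSet_of_designGenerator`.)
[cite: KumarRamyaSaptharishiTengse2022, Lemma 8 and §3.5] -/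
theorem isSuccinctHittingSet_of_hard_designGenerator
    {n a r : ℕ} {𝒞 : Set (MvPolynomial (Fin n) F)} {e : degLEMonomials n → (β ↪ α)}
    (he : IsNWDesign r e) (f : MvPolynomial β F)
    (hhard : ((Nat.choose (2 * n) n) ^ a +
        Fintype.card (degLEMonomials n) * ((f.totalDegree + 1) ^ r * (2 * f.totalDegree + 2)) +
        (Nat.choose (2 * n) n) ^ a * max 1 f.totalDegree + f.totalDegree + Fintype.card β + 4) ^ 7 <
        complexity f)
    (hsucc : ∀ y : α → F, ∃ g ∈ 𝒞,
      ∀ m : degLEMonomials n, coeff (m : Fin n →₀ ℕ) g = eval (y ∘ e m) f) :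
    IsSuccinctHittingSet (degLEMonomials n) 𝒞 (Distinguishers F n a) := by
  classical
  refine isSuccinctHittingSet_of_designGenerator (f := f) (S := fun m => ⇑(e m)) ?_ hsucc
  intro D hD hD0
  rw [← kiGenerator_eq_designGenerator]
  exact kiGenerator_isHittingSetGenerator he f hhard hD.1 hD.2 hD0

/-- **The asymptotic statement for `VP`.** If for every distinguisher level `a` there are `b, n₀`
and, for every `n ≥ n₀`, a block size `m`, a seed length `ℓ`, an intersection bound `r`, a design
`e : degLEMonomials n → (Fin m ↪ Fin ℓ)` and a hard `f ∈ F[x_1..x_m]` (the displayed inequality)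
whose KI generator is `SmallCircuits F n b`-succinct, then `SuccinctHittingSetsForVP F` (FSV
Question 6). The hardness and design parts are supplied by KRST's data (`f = Perm_[p]`, the
Reed–Solomon design); the `VP`-succinctness part is the succinct-generator hypothesis that is not
in print and not derivable from permanent hardness by the known generators (file header) — this
theorem records what it would give, nothing more. [cite: KumarRamyaSaptharishiTengse2022, §3.5 and §4] -/
theorem succinctHittingSetsForVP_of_hard_designGenerators
    (h : ∀ a : ℕ, ∃ b n₀ : ℕ, ∀ n : ℕ, n₀ ≤ n →
      ∃ (m ℓ r : ℕ) (e : degLEMonomials n → (Fin m ↪ Fin ℓ)) (f : MvPolynomial (Fin m) F),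
        IsNWDesign r e ∧
        ((Nat.choose (2 * n) n) ^ a +
          Fintype.card (degLEMonomials n) * ((f.totalDegree + 1) ^ r * (2 * f.totalDegree + 2)) +
          (Nat.choose (2 * n) n) ^ a * max 1 f.totalDegree + f.totalDegree + m + 4) ^ 7 <
          complexity f ∧
        ∀ y : Fin ℓ → F, ∃ g ∈ SmallCircuits F n b,
          ∀ μ : degLEMonomials n, coeff (μ : Fin n →₀ ℕ) g = eval (y ∘ e μ) f) :
    SuccinctHittingSetsForVP F := by
  intro a
  obtain ⟨b, n₀, hb⟩ := h a
  refine ⟨b, n₀, fun n hn => ?_⟩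
  obtain ⟨m, ℓ, r, e, f, he, hhard, hsucc⟩ := hb n hn
  exact isSuccinctHittingSet_of_hard_designGenerator he f (by rwa [Fintype.card_fin]) hsucc

/-- Hence, under the same data (including the `VP`-succinctness hypothesis, which is the
conjectural input), NO algebraically natural proof of any level shows that any family lies
outside `VP`. [cite: KumarRamyaSaptharishiTengse2022, §4] -/
theorem not_naturalProofAgainstVP_of_hard_designGenerators
    (h : ∀ a : ℕ, ∃ b n₀ : ℕ, ∀ n : ℕ, n₀ ≤ n →
      ∃ (m ℓ r : ℕ) (e : degLEMonomials n → (Fin m ↪ Fin ℓ)) (f : MvPolynomial (Fin m) F),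
        IsNWDesign r e ∧
        ((Nat.choose (2 * n) n) ^ a +
          Fintype.card (degLEMonomials n) * ((f.totalDegree + 1) ^ r * (2 * f.totalDegree + 2)) +
          (Nat.choose (2 * n) n) ^ a * max 1 f.totalDegree + f.totalDegree + m + 4) ^ 7 <
          complexity f ∧
        ∀ y : Fin ℓ → F, ∃ g ∈ SmallCircuits F n b,
          ∀ μ : degLEMonomials n, coeff (μ : Fin n →₀ ℕ) g = eval (y ∘ e μ) f)
    (a : ℕ) (t : ∀ n, MvPolynomial (Fin n) F) : ¬ NaturalProofAgainstVP F a t := by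
  exact algebraicNaturalProofs_holds F (succinctHittingSetsForVP_of_hard_designGenerators h) a t

end Engine

section PermanentEngine

variable {F : Type*} [Field F] [CharZero F]

/-- **KRST's argument at a fixed `n`, with every object explicit (unconditional).** Over a field
of characteristic zero, let `p` be a prime with `n < p` and `m² ≤ p`, and suppose the permanent is
hard at `m` relative to the level `a`:
`L(per_m) > (N^a + N_n (m+1)^n (2m+2) + N^a · max 1 m + m + p + 4)^7` (`N = binom(2n,n)`,
`N_n = #degLEMonomials n`). IF the Kabanets–Impagliazzo generator of `Perm_[p]` on the Reed–Solomon
design is `𝒞`-SUCCINCT — for every `y : 𝔽_p × 𝔽_p → F` the polynomial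
`Σ_{|μ| ≤ n} Perm_[p](y|_{S_μ}) x^μ` lies in `𝒞` — then `𝒞` hits every nonzero distinguisher of size
and degree `≤ N^a`. KRST prove the succinctness clause for `𝒞` = their `VNP` slice (§3.4, tree:
`KRSTSuccinctness.lean`); for `𝒞 = SmallCircuits F n b` it is the conjectural input discussed in
the file header (false outside a window of parameters, open inside).
[cite: KumarRamyaSaptharishiTengse2022, Lemma 8 and §3.5] -/
theorem isSuccinctHittingSet_of_permanent_hard
    {n a m p : ℕ} [Fact p.Prime] {𝒞 : Set (MvPolynomial (Fin n) F)} (hnp : n < p)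
    (hmp : m * m ≤ p)
    (hhard : ((Nat.choose (2 * n) n) ^ a +
        Fintype.card (degLEMonomials n) * ((m + 1) ^ n * (2 * m + 2)) +
        (Nat.choose (2 * n) n) ^ a * max 1 m + m + p + 4) ^ 7 < complexity (perPoly (Fin m) F))
    (hsucc : ∀ y : ZMod p × ZMod p → F, ∃ g ∈ 𝒞,
      ∀ μ : degLEMonomials n, coeff (μ : Fin n →₀ ℕ) g = eval (y ∘ krstDesign p n μ) (perPad F hmp)) :
    IsSuccinctHittingSet (degLEMonomials n) 𝒞 (Distinguishers F n a) := by
  refine isSuccinctHittingSet_of_hard_designGenerator (isNWDesign_krstDesign p n hnp)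
    (perPad F hmp) (lt_of_le_of_lt ?_ (hhard.trans_eq (complexity_perPad hmp).symm)) hsucc
  have hd := totalDegree_perPad_le (F := F) hmp
  rw [Fintype.card_fin]
  gcongr

end PermanentEngine

end Literature.Barriers.ValiantsHypothesis

end
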